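import Summits.HubbardSuperconductivity.HubbardLadder.Bounds.TwistedActivitySmallness
import Summits.HubbardSuperconductivity.HubbardLadder.Bounds.CatalanPolymerSmallness
import HarnessLib

/-!
# The weighted degree of the seam-twisted `t–t'` coupling, and the bridge to the tree's activities

HONEST FRAMING (cell pub-hubbard): ladder R1–R4 with certified numbers; no claim on H/H₀. This file
is bookkeeping for a BOUND FOR A MODEL CLASS (the seam-twisted `t–t'` Hubbard torus); no materials
claim. LEAN FILING REQUEST #195 part 4 of 5 (bounds g25); imports #181.5 (`TwistedActivitySmallness`,
hence #181.2–#181.4) and part 3 (`CatalanPolymerSmallness`).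

1. BRIDGE (`siteActivityC_eq_couplingActivity`): the bond-dependent polymer activities `siteActivityC`
   of #181.4 ARE the tree's coupling-function activities `couplingActivity`
   (`Literature.MathematicalPhysics.QuantumLattice.HubbardCouplingWeights`: `restrictCoupling =
   couplingRestrict`, `bondWeightC = couplingWeight`), so part 3's smallness theorem applies to them.
2. INDICATOR SUMS (`sum_norm_indicatorCoupling_le`, `card_filter_le_of_cover`): for an indicator
   coupling `ic(b) = Σ_j 1[b = a j] r_j`, `Σ_{b ∈ S} |ic(b)| ≤ Σ_{j : a j ∈ S} |r_j|`.
3. DEGREE (`sum_norm_ttFluxCoupling_le`): every one of the four bond families of the dictionary of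
   #181.3 (`nnFwdBond`, `nnBwdBond`, `diagFwdBond`, `diagBwdBond`) has at most `8` index triples whose
   bond passes through a given site (cover maps from `Fin 2 × Fin 2 × Bool`; no injectivity needed), so
   the weighted degree of the twisted coupling obeys `Σ_{b ∋ v} |c_θ(b)| ≤ 16 |β| (1+|t'|)` at every
   site `v`, for every twist `θ` — the bound `W ≤ W̄` of bounds.tex §12, Lemma 12.4, in Lean.

References: D. Ueltschi, J. Stat. Phys. 95 (1999) 693 (arXiv:cond-mat/9810320) §2.3 [Ueltschi1999];
Xu et al., Science 384 (2024) eadh7691, eq. (1) (the `t–t'` model) [XuEtAl2024].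
-/

noncomputable section

namespace Summit.HubbardSuperconductivity.HubbardLadder.Bounds

open Matrix Finset Literature.MathematicalPhysics.QuantumLattice
  Literature.MathematicalPhysics.QuantumFieldTheory Literature.Probability.LatticeModels
open scoped ComplexConjugate ComplexOrder

/-! ### Bridge: the activities of #181.4 are the tree's coupling-function activities -/

section Bridge

variable {Λ : Type*} [LinearOrder Λ] [Fintype Λ]

omit [Fintype Λ] in
/-- `restrictCoupling` agrees with the tree's `couplingRestrict`. [this file] -/
theorem restrictCoupling_eq_couplingRestrict (c : Bond Λ → ℂ) (K : Finset (Bond Λ)) :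
    restrictCoupling c K = couplingRestrict c K := by
  funext b
  rw [restrictCoupling_apply, couplingRestrict_apply]

/-- `bondWeightC = couplingWeight`: the inclusion–exclusion sum of #181.4 is the tree's iterated
difference (`couplingWeight_eq_sum`). [folklore bookkeeping] -/
theorem bondWeightC_eq_couplingWeight (β U μ : ℂ) (c : Bond Λ → ℂ) (K : Finset (Bond Λ)) :
    bondWeightC β U μ c K = couplingWeight β U μ c K := by
  rw [couplingWeight_eq_sum, bondWeightC]
  simp only [restrictCoupling_eq_couplingRestrict]

/-- `siteActivityC P = couplingActivity P`. [folklore bookkeeping] -/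
theorem siteActivityC_eq_couplingActivity (P : Finset (Bond Λ)) (β U μ : ℂ) (c : Bond Λ → ℂ) :
    siteActivityC P β U μ c = couplingActivity P β U μ c := by
  funext A
  rw [siteActivityC_apply, couplingActivity_apply]
  simp only [bondWeightC_eq_couplingWeight]

end Bridge

/-! ### Sums of indicator couplings over bond sets -/

section Indicator

/-- `Σ_{b ∈ S} |Σ_j [b = a_j] r_j| ≤ Σ_{j : a_j ∈ S} |r_j|` (no injectivity of `a` needed).
[folklore bookkeeping] -/
theorem sum_norm_indicatorCoupling_le {Λ ι : Type*} [Fintype ι] [DecidableEq (Bond Λ)]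
    (a : ι → Bond Λ) (r : ι → ℂ) (S : Finset (Bond Λ)) :
    ∑ b ∈ S, ‖indicatorCoupling a r b‖ ≤ ∑ j ∈ Finset.univ.filter (fun j => a j ∈ S), ‖r j‖ := by
  calc ∑ b ∈ S, ‖indicatorCoupling a r b‖
      ≤ ∑ b ∈ S, ∑ j, (if b = a j then ‖r j‖ else 0) := by
        refine Finset.sum_le_sum fun b _ => ?_
        simp only [indicatorCoupling]
        refine (norm_sum_le _ _).trans (Finset.sum_le_sum fun j _ => ?_)
        split_ifs
        · exact le_rfl
        · rw [norm_zero]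
    _ = ∑ j, ∑ b ∈ S, (if b = a j then ‖r j‖ else 0) := Finset.sum_comm
    _ = ∑ j, (if a j ∈ S then ‖r j‖ else 0) := by
        refine Finset.sum_congr rfl fun j _ => ?_
        rw [Finset.sum_ite_eq' S (a j) (fun _ => ‖r j‖)]
    _ = ∑ j ∈ Finset.univ.filter (fun j => a j ∈ S), ‖r j‖ := (Finset.sum_filter _ _).symm

/-- A filter covered by the image of a map from a finite type has at most that many elements.
[folklore bookkeeping] -/
theorem card_filter_le_of_cover {ι κ : Type*} [Fintype ι] [Fintype κ] (p : ι → Prop) [DecidablePred p]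
    (g : κ → ι) (hg : ∀ j, p j → ∃ k, g k = j) : (Finset.univ.filter p).card ≤ Fintype.card κ := by
  classical
  calc (Finset.univ.filter p).card ≤ ((Finset.univ : Finset κ).image g).card := by
        refine Finset.card_le_card fun j hj => ?_
        obtain ⟨k, hk⟩ := hg j (Finset.mem_filter.1 hj).2
        exact Finset.mem_image.2 ⟨k, Finset.mem_univ _, hk⟩
    _ ≤ (Finset.univ : Finset κ).card := Finset.card_image_le
    _ = Fintype.card κ := Finset.card_univ

end Indicator

/-! ### The weighted degree of the twisted `t–t'` coupling -/

section Degree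

variable {L : ℕ} [NeZero L]

/-- `|Fin 2 × Fin 2 × Bool| = 8`. [this file] -/
theorem card_fin2_fin2_bool : Fintype.card (Fin 2 × Fin 2 × Bool) = 8 := by simp

/-- Inverting `FermionTorus.ofTorusSite`. [this file] -/
theorem toTorusSite_eq_of_eq_ofTorusSite {v : FermionTorus 2 L} {x : TorusSite 2 L}
    (h : v = FermionTorus.ofTorusSite x) : FermionTorus.toTorusSite v = x := by
  rw [h, FermionTorus.toTorusSite_ofTorusSite]

/-- At most `8` forward nearest-neighbour index triples `(x, i, σ)` give a bond through `v`
(`x = v` or `x = v - e_i`). [folklore bookkeeping] -/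
theorem card_filter_mem_verts_nnFwdBond_le (v : FermionTorus 2 L) :
    (Finset.univ.filter (fun j : Site 2 L × Fin 2 × Fin 2 => v ∈ Bond.verts (nnFwdBond L j))).card ≤ 8 := by
  rw [← card_fin2_fin2_bool]
  refine card_filter_le_of_cover _ (fun k : Fin 2 × Fin 2 × Bool =>
    ((if k.2.2 = true then FermionTorus.toTorusSite v - Pi.single k.1 1 else FermionTorus.toTorusSite v),
      k.1, k.2.1)) ?_
  rintro ⟨x, i, σ⟩ hj
  rcases mem_verts_iff.1 hj with h | h
  · refine ⟨(i, σ, true), ?_⟩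
    have hx : FermionTorus.toTorusSite v = x + Pi.single i 1 := by
      rw [toTorusSite_eq_of_eq_ofTorusSite h]; rfl
    simp [hx]
  · refine ⟨(i, σ, false), ?_⟩
    have hx : FermionTorus.toTorusSite v = x := toTorusSite_eq_of_eq_ofTorusSite h
    simp [hx]

/-- The same count for backward nearest-neighbour bonds. [folklore bookkeeping] -/
theorem card_filter_mem_verts_nnBwdBond_le (v : FermionTorus 2 L) :
    (Finset.univ.filter (fun j : Site 2 L × Fin 2 × Fin 2 => v ∈ Bond.verts (nnBwdBond L j))).card ≤ 8 := by
  rw [← card_fin2_fin2_bool]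
  refine card_filter_le_of_cover _ (fun k : Fin 2 × Fin 2 × Bool =>
    ((if k.2.2 = true then FermionTorus.toTorusSite v - Pi.single k.1 1 else FermionTorus.toTorusSite v),
      k.1, k.2.1)) ?_
  rintro ⟨x, i, σ⟩ hj
  rcases mem_verts_iff.1 hj with h | h
  · refine ⟨(i, σ, false), ?_⟩
    have hx : FermionTorus.toTorusSite v = x := toTorusSite_eq_of_eq_ofTorusSite h
    simp [hx]
  · refine ⟨(i, σ, true), ?_⟩
    have hx : FermionTorus.toTorusSite v = x + Pi.single i 1 := by
      rw [toTorusSite_eq_of_eq_ofTorusSite h]; rfl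
    simp [hx]

/-- At most `8` forward diagonal index triples `(s, x, σ)` give a bond through `v`. [folklore bookkeeping] -/
theorem card_filter_mem_verts_diagFwdBond_le (v : FermionTorus 2 L) :
    (Finset.univ.filter (fun j : Fin 2 × Site 2 L × Fin 2 => v ∈ Bond.verts (diagFwdBond L j))).card ≤ 8 := by
  rw [← card_fin2_fin2_bool]
  refine card_filter_le_of_cover _ (fun k : Fin 2 × Fin 2 × Bool =>
    (k.1, (if k.2.2 = true then FermionTorus.toTorusSite v - torusDiagJump L k.1 else FermionTorus.toTorusSite v),
      k.2.1)) ?_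
  rintro ⟨s, x, σ⟩ hj
  rcases mem_verts_iff.1 hj with h | h
  · refine ⟨(s, σ, true), ?_⟩
    have hx : FermionTorus.toTorusSite v = x + torusDiagJump L s := toTorusSite_eq_of_eq_ofTorusSite h
    simp [hx]
  · refine ⟨(s, σ, false), ?_⟩
    have hx : FermionTorus.toTorusSite v = x := toTorusSite_eq_of_eq_ofTorusSite h
    simp [hx]

/-- The same count for backward diagonal bonds. [folklore bookkeeping] -/
theorem card_filter_mem_verts_diagBwdBond_le (v : FermionTorus 2 L) :
    (Finset.univ.filter (fun j : Fin 2 × Site 2 L × Fin 2 => v ∈ Bond.verts (diagBwdBond L j))).card ≤ 8 := by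
  rw [← card_fin2_fin2_bool]
  refine card_filter_le_of_cover _ (fun k : Fin 2 × Fin 2 × Bool =>
    (k.1, (if k.2.2 = true then FermionTorus.toTorusSite v - torusDiagJump L k.1 else FermionTorus.toTorusSite v),
      k.2.1)) ?_
  rintro ⟨s, x, σ⟩ hj
  rcases mem_verts_iff.1 hj with h | h
  · refine ⟨(s, σ, false), ?_⟩
    have hx : FermionTorus.toTorusSite v = x := toTorusSite_eq_of_eq_ofTorusSite h
    simp [hx]
  · refine ⟨(s, σ, true), ?_⟩
    have hx : FermionTorus.toTorusSite v = x + torusDiagJump L s := toTorusSite_eq_of_eq_ofTorusSite h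
    simp [hx]

omit [NeZero L] in
/-- One bond family: `Σ_{b ∈ S} |ic(b)| ≤ 8 M` if every bond of `S` passes through `v`, at most `8`
indices give a bond through `v`, and `|r_j| = M`. [folklore bookkeeping] -/
theorem sum_norm_indicatorCoupling_le_eight_mul {ι : Type*} [Fintype ι] (a : ι → Bond (FermionTorus 2 L))
    (r : ι → ℂ) {M : ℝ} (hM : 0 ≤ M) (hr : ∀ j, ‖r j‖ = M) (v : FermionTorus 2 L)
    (h8 : (Finset.univ.filter (fun j => v ∈ Bond.verts (a j))).card ≤ 8)
    (S : Finset (Bond (FermionTorus 2 L))) (hS : ∀ b ∈ S, v ∈ Bond.verts b) :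
    ∑ b ∈ S, ‖indicatorCoupling a r b‖ ≤ 8 * M := by
  refine (sum_norm_indicatorCoupling_le a r S).trans ?_
  calc ∑ j ∈ Finset.univ.filter (fun j => a j ∈ S), ‖r j‖
      ≤ ∑ j ∈ Finset.univ.filter (fun j => v ∈ Bond.verts (a j)), ‖r j‖ := by
        refine Finset.sum_le_sum_of_subset_of_nonneg (fun j hj => ?_) fun _ _ _ => norm_nonneg _
        exact Finset.mem_filter.2 ⟨Finset.mem_univ _, hS _ (Finset.mem_filter.1 hj).2⟩
    _ = (Finset.univ.filter (fun j => v ∈ Bond.verts (a j))).card * M := by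
        rw [Finset.sum_congr rfl fun j _ => hr j, Finset.sum_const, nsmul_eq_mul]
    _ ≤ 8 * M := by
        refine mul_le_mul_of_nonneg_right ?_ hM
        exact_mod_cast h8

/-- **The weighted degree of the twisted coupling**: `Σ_{b ∋ v} |c_θ(b)| ≤ 16 |β| (1+|t'|)` at every
site `v`, for every twist `θ` (the hypothesis "every bond of `S` passes through `v`" is spelled out on
the components so that the lemma applies under any `DecidableEq` instance). [programme: bounds.tex §12,
Lemma 12.4 (the bound `W ≤ W̄`)] -/
theorem sum_norm_ttFluxCoupling_le (β t' θ : ℝ) (v : FermionTorus 2 L)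
    (S : Finset (Bond (FermionTorus 2 L))) (hS' : ∀ b ∈ S, v = b.1 ∨ v = b.2.1) :
    ∑ b ∈ S, ‖ttFluxCoupling L β t' θ b‖ ≤ 16 * (|β| * (1 + |t'|)) := by
  have hS : ∀ b ∈ S, v ∈ Bond.verts b := fun b hb => mem_verts_iff.2 (hS' b hb)
  have hβ : 0 ≤ |β| := abs_nonneg β
  have hβt : 0 ≤ |β| * |t'| := mul_nonneg hβ (abs_nonneg t')
  have e1 : ∀ j : Site 2 L × Fin 2 × Fin 2, ‖(β : ℂ) * seamAmp L θ j.1 j.2.1‖ = |β| := fun j => by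
    rw [norm_mul, Complex.norm_real, Real.norm_eq_abs, norm_seamAmp, mul_one]
  have e2 : ∀ j : Site 2 L × Fin 2 × Fin 2, ‖(β : ℂ) * conj (seamAmp L θ j.1 j.2.1)‖ = |β| := fun j => by
    rw [norm_mul, Complex.norm_real, Real.norm_eq_abs, RCLike.norm_conj, norm_seamAmp, mul_one]
  have e3 : ∀ j : Fin 2 × Site 2 L × Fin 2, ‖(β : ℂ) * (t' : ℂ) * seamAmp L θ j.2.1 0‖ = |β| * |t'| := fun j => by
    rw [norm_mul, norm_mul, Complex.norm_real, Complex.norm_real, Real.norm_eq_abs, Real.norm_eq_abs,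
      norm_seamAmp, mul_one]
  have e4 : ∀ j : Fin 2 × Site 2 L × Fin 2, ‖(β : ℂ) * (t' : ℂ) * conj (seamAmp L θ j.2.1 0)‖ = |β| * |t'| := fun j => by
    rw [norm_mul, norm_mul, Complex.norm_real, Complex.norm_real, Real.norm_eq_abs, Real.norm_eq_abs,
      RCLike.norm_conj, norm_seamAmp, mul_one]
  have h1 := sum_norm_indicatorCoupling_le_eight_mul (nnFwdBond L) _ hβ e1 v
    (card_filter_mem_verts_nnFwdBond_le v) S hS
  have h2 := sum_norm_indicatorCoupling_le_eight_mul (nnBwdBond L) _ hβ e2 v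
    (card_filter_mem_verts_nnBwdBond_le v) S hS
  have h3 := sum_norm_indicatorCoupling_le_eight_mul (diagFwdBond L) _ hβt e3 v
    (card_filter_mem_verts_diagFwdBond_le v) S hS
  have h4 := sum_norm_indicatorCoupling_le_eight_mul (diagBwdBond L) _ hβt e4 v
    (card_filter_mem_verts_diagBwdBond_le v) S hS
  calc ∑ b ∈ S, ‖ttFluxCoupling L β t' θ b‖
      ≤ ∑ b ∈ S, (‖indicatorCoupling (nnFwdBond L) (fun j => (β : ℂ) * seamAmp L θ j.1 j.2.1) b‖ +
          ‖indicatorCoupling (nnBwdBond L) (fun j => (β : ℂ) * conj (seamAmp L θ j.1 j.2.1)) b‖ +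
          ‖indicatorCoupling (diagFwdBond L) (fun j => (β : ℂ) * (t' : ℂ) * seamAmp L θ j.2.1 0) b‖ +
          ‖indicatorCoupling (diagBwdBond L) (fun j => (β : ℂ) * (t' : ℂ) * conj (seamAmp L θ j.2.1 0)) b‖) := by
        refine Finset.sum_le_sum fun b _ => ?_
        simp only [ttFluxCoupling, Pi.add_apply]
        exact (norm_add_le _ _).trans (add_le_add ((norm_add_le _ _).trans (add_le_add
          ((norm_add_le _ _).trans le_rfl) le_rfl)) le_rfl)
    _ ≤ 8 * |β| + 8 * |β| + 8 * (|β| * |t'|) + 8 * (|β| * |t'|) := by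
        rw [Finset.sum_add_distrib, Finset.sum_add_distrib, Finset.sum_add_distrib]
        exact add_le_add (add_le_add (add_le_add h1 h2) h3) h4
    _ = 16 * (|β| * (1 + |t'|)) := by ring

end Degree

end Summit.HubbardSuperconductivity.HubbardLadder.Bounds

end
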